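import Summits.FinalStateConjecture.FinalStateConjecture.Theorems.PhotonSphereChannelsExteriorEnergyRW
import Summits.FinalStateConjecture.FinalStateConjecture.Theorems.PhotonSphereChannelsFarPotentialPower
import Literature.Analysis.PDE.Wave1DFarModelComparisonTwoSided
import Literature.Analysis.PDE.InverseSquareConeModelWave
import Literature.Analysis.PDE.FarChannelsStep
import Literature.Analysis.ODE.InverseCoordSmooth

/-!
# Crux `WindowedShellChannels` (stmt-FinalStateConjecture-14085), line `Sketch` — stub `stub_farHalfShare`,
# part 1: the two-sided far estimate at apex `0` for compactly supported far data (one mode)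

For one mode `(s, ℓ)`, `s ≤ 2`, `s ≤ ℓ`, of the unit-mass Regge–Wheeler equation along the centred
tortoise line `r = tortoiseRadius one_pos 0` there is `R_c = R_c(s, ℓ)` such that every global `C²`
solution `ψ` whose Cauchy data are supported in a compact far interval `(R₀, B)`, `R_c ≤ R₀ ≤ B`,
radiates at least one sixteenth of its energy ahead of the two apex-`0` cones
`{x > |t|}` in the two time directions together:

  `(1/16)·E ≤ liminf_{t→+∞} ∫⁻_{x>|t|} e[ψ](t) + liminf_{t→−∞} ∫⁻_{x>|t|} e[ψ](t)`

(`stub_farHalfShare_compact`, part 2).  Proof: compare `ψ` with a MODEL wave `φ` with the same data —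
for `ℓ ≥ 1` the cut regular exact inverse-square wave (`Literature.Analysis.PDE.inverseSquare_coneModelWave`,
model potential `ℓ(ℓ+1)ι²`, `ι` a smooth `1/x`), for `ℓ = 0` d'Alembert's free wave
(`free_coneModelWave`) — whose far energies at apex `0` carry its full model energy
(`E₀ ≤ L⁺(0) + L⁻(0)`, the odd-dimensional exterior-energy identity with apex at the centre), and
transfer through the far-cone Duhamel comparison at apex `0`
(`Literature.Analysis.PDE.far_model_comparison_liminf_atTop/atBot`): finite speed of propagation keeps
the source `(V₀ − V)ψ` at `x ≥ R₀/2`, where the Regge–Wheeler potential is inverse-square up to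
`200(ℓ+1)² x^{-5/2}` (`rwPotential_far_inverseSquare`; for `ℓ = 0`, `V ≤ 54/x³`), so the transfer
costs `O(E/R₀)`.  Sub-namespace `FarHalfShareModel`: the potential-independent core `stub_farHalfShare_transfer` and the
far-potential bookkeeping.  Part 2 (`…StubFarHalfShare`) removes the compact support and adds the
time parity.  No definitions. [folklore in method; new]
-/

noncomputable section

set_option linter.dupNamespace false

namespace Summit.FinalStateConjecture.FinalStateConjecture.Theorems.WindowedShellChannelsSketch

open Literature.Geometry.Lorentzian Literature.Geometry.Lorentzian.ReggeWheeler Filter Set MeasureTheory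
open Literature.Analysis.PDE Literature.Analysis.ODE Real intervalIntegral
open scoped ENNReal Topology

namespace FarHalfShareModel

/-! ### The potential-independent core -/

/-- **Core of the transfer.**  Let `V ≥ 0` be differentiable and `V₀ ≥ 0` continuous with
`(V₀ − V)² ≤ D²x⁻³V` and `V₀/2 ≤ V` beyond `X > 0`; let `ψ` be a global `C²` solution of the
`V`-equation with Cauchy data supported in `(R₀, B)`, `R₀ ≥ max(2X, 4096 D²)`, of energy `E ≤ 2E₀`, and
let `φ` be a global `C²` function solving the `V₀`-equation on the closed cone `{|t| ≤ x}` with the data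
of `ψ`, whose far energies at apex `0` carry `E₀`.  Then `E/16 ≤ F⁺ + F⁻`, the far energies of `ψ` at
apex `0` in the two time directions. [folklore] -/
theorem stub_farHalfShare_transfer {V V₀ : ℝ → ℝ} {ψ φ : ℝ → ℝ → ℝ} (hVd : Differentiable ℝ V) (hV0 : ∀ x, 0 ≤ V x) (hV₀ : Continuous V₀)
    (hV₀0 : ∀ x, 0 ≤ V₀ x) {X R₀ B D E₀ : ℝ} (hX : 0 < X) (hXR : 2 * X ≤ R₀) (hD : 0 ≤ D)
    (hbig : 4096 * D ^ 2 ≤ R₀) (hR₀B : R₀ ≤ B)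
    (hclose : ∀ x, X ≤ x → (V₀ x - V x) ^ 2 ≤ D ^ 2 * x ^ (-(3 : ℝ)) * V x)
    (hlow : ∀ x, X ≤ x → (1 - 1 / 2) * V₀ x ≤ V x)
    (hψ : IsSolution V ψ) (hsupp : CauchyDataSupportedOn ψ (Ioo R₀ B))
    (hφ : ContDiff ℝ 2 (Function.uncurry φ))
    (hφsol : ∀ t x, |t| ≤ x →
      iteratedDeriv 2 (fun τ => φ τ x) t - iteratedDeriv 2 (φ t) x + V₀ x * φ t x = 0)
    (hdat : ∀ x, φ 0 x = ψ 0 x ∧ deriv (fun τ => φ τ x) 0 = deriv (fun τ => ψ τ x) 0)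
    (hE₀ : (totalEnergy V ψ 0).toReal ≤ 2 * E₀)
    (hmodel : ENNReal.ofReal E₀
      ≤ liminf (fun t => ∫⁻ x in Ioi |t|, ENNReal.ofReal (deriv (fun τ => φ τ x) t ^ 2
          + deriv (φ t) x ^ 2 + V₀ x * φ t x ^ 2)) atTop
        + liminf (fun t => ∫⁻ x in Ioi |t|, ENNReal.ofReal (deriv (fun τ => φ τ x) t ^ 2
          + deriv (φ t) x ^ 2 + V₀ x * φ t x ^ 2)) atBot) :
    ENNReal.ofReal (1 / 16) * totalEnergy V ψ 0
      ≤ liminf (fun t => ∫⁻ x in Ioi |t|, ENNReal.ofReal (energyDensity V ψ t x)) atTop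
        + liminf (fun t => ∫⁻ x in Ioi |t|, ENNReal.ofReal (energyDensity V ψ t x)) atBot := by
  have hVc : Continuous V := hVd.continuous
  -- the energy is finite and conserved
  have htop : totalEnergy V ψ 0 ≠ ⊤ := (RW.totalEnergy_lt_top hVd hV0 hψ hR₀B hsupp 0).ne
  set E : ℝ := (totalEnergy V ψ 0).toReal with hE
  have hE0 : 0 ≤ E := ENNReal.toReal_nonneg
  have hEeq : ENNReal.ofReal E = totalEnergy V ψ 0 := ENNReal.ofReal_toReal htop
  have hEψ : ∀ τ, ∫⁻ x, ENNReal.ofReal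
      (deriv (fun s => ψ s x) τ ^ 2 + deriv (ψ τ) x ^ 2 + V x * ψ τ x ^ 2) ≤ ENNReal.ofReal E := by
    intro τ
    have h := RW.totalEnergy_eq_totalEnergy_zero hVd hV0 hψ hR₀B hsupp τ
    unfold totalEnergy energyDensity at h
    rw [hEeq]
    exact h.le
  -- domain of dependence
  have hvan : ∀ t x, x + |t| < R₀ → ψ t x = 0 := fun t x hx =>
    RW.eq_zero_of_cauchyDataSupportedOn hVd hV0 hψ hsupp (Or.inr (by linarith))
  have hdat' : ∀ x, 0 < x → φ 0 x = ψ 0 x ∧ deriv (fun τ => φ τ x) 0 = deriv (fun τ => ψ τ x) 0 :=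
    fun x _ => hdat x
  have hsol : ∀ t x, iteratedDeriv 2 (fun τ => ψ τ x) t - iteratedDeriv 2 (ψ t) x + V x * ψ t x = 0 :=
    fun t x => hψ.2 (t, x)
  -- the comparison in the two time directions
  have hκ0 : (0 : ℝ) ≤ 1 / 2 := by norm_num
  have hκ1 : (1 / 2 : ℝ) < 1 := by norm_num
  have hT := far_model_comparison_liminf_atTop hVc hV0 hV₀ hV₀0 hψ.1 hsol hφ hφsol hX hXR hD hκ0 hκ1
    hE0 hclose hlow hvan hdat' hEψ
  have hB := far_model_comparison_liminf_atBot hVc hV0 hV₀ hV₀0 hψ.1 hsol hφ hφsol hX hXR hD hκ0 hκ1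
    hE0 hclose hlow hvan hdat' hEψ
  have e4 : ENNReal.ofReal (2 / (1 - 1 / 2)) = ENNReal.ofReal 4 := by norm_num
  rw [e4] at hT hB
  set Fp := liminf (fun t => ∫⁻ x in Ioi |t|, ENNReal.ofReal (deriv (fun τ => ψ τ x) t ^ 2
    + deriv (ψ t) x ^ 2 + V x * ψ t x ^ 2)) atTop with hFp
  set Fm := liminf (fun t => ∫⁻ x in Ioi |t|, ENNReal.ofReal (deriv (fun τ => ψ τ x) t ^ 2
    + deriv (ψ t) x ^ 2 + V x * ψ t x ^ 2)) atBot with hFm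
  set K := ENNReal.ofReal (512 * D ^ 2 * E / R₀) with hK
  -- `ofReal E ≤ 8 (Fp + Fm) + 4K`
  have h1 : ENNReal.ofReal E ≤ ENNReal.ofReal 8 * (Fp + Fm) + 4 * K := by
    have h2 : ENNReal.ofReal E ≤ 2 * ENNReal.ofReal E₀ := by
      rw [show (2 : ℝ≥0∞) = ENNReal.ofReal 2 by simp, ← ENNReal.ofReal_mul (by norm_num)]
      exact ENNReal.ofReal_le_ofReal hE₀
    calc ENNReal.ofReal E ≤ 2 * ENNReal.ofReal E₀ := h2
      _ ≤ 2 * ((ENNReal.ofReal 4 * Fp + K) + (ENNReal.ofReal 4 * Fm + K)) := by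
          gcongr
          exact hmodel.trans (add_le_add hT hB)
      _ = ENNReal.ofReal 8 * (Fp + Fm) + 4 * K := by
          have : (2 : ℝ≥0∞) * ENNReal.ofReal 4 = ENNReal.ofReal 8 := by
            rw [show (2 : ℝ≥0∞) = ENNReal.ofReal 2 by simp, ← ENNReal.ofReal_mul (by norm_num)]
            norm_num
          rw [← this]
          ring
  -- `4K ≤ ofReal (E/2)`
  have hR₀0 : 0 < R₀ := by linarith
  have h4K : 4 * K ≤ ENNReal.ofReal (E / 2) := by
    rw [hK, show (4 : ℝ≥0∞) = ENNReal.ofReal 4 by simp, ← ENNReal.ofReal_mul (by norm_num)]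
    refine ENNReal.ofReal_le_ofReal ?_
    rw [show 4 * (512 * D ^ 2 * E / R₀) = (2048 * D ^ 2 / R₀) * E by ring]
    have hq : 2048 * D ^ 2 / R₀ ≤ 1 / 2 := by
      rw [div_le_iff₀ hR₀0]; linarith
    nlinarith
  -- conclude
  have h3 : ENNReal.ofReal (E / 2) ≤ ENNReal.ofReal 8 * (Fp + Fm) := by
    have h5 : ENNReal.ofReal E ≤ ENNReal.ofReal 8 * (Fp + Fm) + ENNReal.ofReal (E / 2) :=
      h1.trans (by gcongr)
    have h6 : ENNReal.ofReal E - ENNReal.ofReal (E / 2) = ENNReal.ofReal (E / 2) := by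
      rw [← ENNReal.ofReal_sub _ (by linarith)]
      congr 1; ring
    rw [← h6]
    exact tsub_le_iff_right.2 h5
  have h7 : ENNReal.ofReal 8 * (ENNReal.ofReal (1 / 16) * totalEnergy V ψ 0)
      ≤ ENNReal.ofReal 8 * (Fp + Fm) := by
    rw [← hEeq, ← mul_assoc, ← ENNReal.ofReal_mul (by norm_num), ← ENNReal.ofReal_mul (by norm_num)]
    rw [show 8 * (1 / 16) * E = E / 2 by ring]
    exact h3
  have h8 := (ENNReal.mul_le_mul_iff_right (by norm_num) ENNReal.ofReal_ne_top).1 h7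
  unfold energyDensity
  exact h8

/-! ### The far Regge–Wheeler potential of one mode -/

/-- Power algebra: `(x^{-5/2})² = x⁻³ · (x²)⁻¹` for `x > 0`. [folklore] -/
theorem rpow_neg_five_halves_sq {x : ℝ} (hx : 0 < x) :
    (x ^ (-(5 / 2 : ℝ))) ^ 2 = x ^ (-(3 : ℝ)) * (x ^ 2)⁻¹ := by
  rw [← rpow_natCast (x ^ (-(5 / 2 : ℝ))) 2, ← rpow_mul hx.le, ← rpow_natCast x 2,
    ← rpow_neg hx.le, ← rpow_add hx]
  norm_num

/-- Power algebra: `x^{-5/2} = x^{-1/2} · (x²)⁻¹` for `x > 0`, and `x^{-1/2} ≤ 1/(2A)` once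
`x ≥ 4A²` (`A > 0`). [folklore] -/
theorem rpow_neg_five_halves_le {x A : ℝ} (hA : 0 < A) (hx : 4 * A ^ 2 ≤ x) :
    A * x ^ (-(5 / 2 : ℝ)) ≤ 1 / 2 * (x ^ 2)⁻¹ := by
  have hx0 : 0 < x := lt_of_lt_of_le (by positivity) hx
  have e1 : x ^ (-(5 / 2 : ℝ)) = x ^ (-(1 / 2 : ℝ)) * (x ^ 2)⁻¹ := by
    rw [← rpow_natCast x 2, ← rpow_neg hx0.le, ← rpow_add hx0]; norm_num
  have e2 : x ^ (-(1 / 2 : ℝ)) ≤ 1 / (2 * A) := by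
    have h1 : x ^ (-(1 / 2 : ℝ)) ≤ (4 * A ^ 2) ^ (-(1 / 2 : ℝ)) :=
      rpow_le_rpow_of_nonpos (by positivity) hx (by norm_num)
    have h2 : (4 * A ^ 2 : ℝ) ^ (-(1 / 2 : ℝ)) = 1 / (2 * A) := by
      rw [show (4 * A ^ 2 : ℝ) = (2 * A) ^ 2 by ring, ← rpow_natCast (2 * A) 2,
        ← rpow_mul (by positivity)]
      norm_num
      rw [rpow_neg_one]; ring
    rw [h2] at h1; exact h1
  rw [e1, ← mul_assoc]
  refine mul_le_mul_of_nonneg_right ?_ (by positivity)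
  calc A * x ^ (-(1 / 2 : ℝ)) ≤ A * (1 / (2 * A)) := mul_le_mul_of_nonneg_left e2 hA.le
    _ = 1 / 2 := by field_simp

/-- **Far bounds for `ℓ ≥ 1`.**  Along the centred unit-mass tortoise line, for
`x ≥ max 9 (4A²)`, `A = 200(ℓ+1)²`: `V₀/2 ≤ V ≤ (3/2)V₀` and `(V₀ − V)² ≤ A² x⁻³ V`, where
`V₀ = ℓ(ℓ+1)/x²`. [folklore] -/
theorem far_bounds_pos {s ℓ : ℕ} (hs : s ≤ 2) (hℓ : 1 ≤ ℓ) {x : ℝ}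
    (hx : max 9 (4 * (200 * ((ℓ : ℝ) + 1) ^ 2) ^ 2) ≤ x) :
    (1 - 1 / 2) * ((ℓ : ℝ) * (ℓ + 1) * (x ^ 2)⁻¹)
        ≤ linePotential 1 s ℓ (tortoiseRadius one_pos 0) x ∧
      linePotential 1 s ℓ (tortoiseRadius one_pos 0) x ≤ 3 / 2 * ((ℓ : ℝ) * (ℓ + 1) * (x ^ 2)⁻¹) ∧
      ((ℓ : ℝ) * (ℓ + 1) * (x ^ 2)⁻¹ - linePotential 1 s ℓ (tortoiseRadius one_pos 0) x) ^ 2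
        ≤ (200 * ((ℓ : ℝ) + 1) ^ 2) ^ 2 * x ^ (-(3 : ℝ))
          * linePotential 1 s ℓ (tortoiseRadius one_pos 0) x := by
  set A : ℝ := 200 * ((ℓ : ℝ) + 1) ^ 2 with hA
  have hA0 : 0 < A := by positivity
  have h9 : 9 ≤ x := (le_max_left _ _).trans hx
  have hx0 : 0 < x := by linarith
  have hr := isTortoiseRadius_tortoiseRadius one_pos (0 : ℝ)
  have hfar := rwPotential_far_inverseSquare hr hs ℓ (y := x)
    (by rw [mul_one]; exact max_le h9 (by linarith))
  rw [zero_add, Real.sqrt_one] at hfar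
  set W : ℝ := linePotential 1 s ℓ (tortoiseRadius one_pos 0) x with hW
  have hWeq : (1 - 2 * 1 / tortoiseRadius one_pos 0 x) * ((ℓ : ℝ) * ((ℓ : ℝ) + 1)
      / tortoiseRadius one_pos 0 x ^ 2 + (1 - (s : ℝ) ^ 2) * (2 * 1) / tortoiseRadius one_pos 0 x ^ 3)
      = W := by
    simp only [hW, linePotential_apply, rwPotential]
  rw [hWeq, mul_one, ← hA] at hfar
  set V₀ : ℝ := (ℓ : ℝ) * (ℓ + 1) * (x ^ 2)⁻¹ with hV₀
  have hV₀eq : (ℓ : ℝ) * ((ℓ : ℝ) + 1) / x ^ 2 = V₀ := by rw [hV₀, div_eq_mul_inv]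
  rw [hV₀eq] at hfar
  have hℓ1 : (1 : ℝ) ≤ (ℓ : ℝ) * (ℓ + 1) := by
    have : (1 : ℝ) ≤ ℓ := by exact_mod_cast hℓ
    nlinarith
  -- `A x^{-5/2} ≤ V₀ / 2`
  have hsmall : A * x ^ (-(5 / 2 : ℝ)) ≤ 1 / 2 * V₀ := by
    have h1 := rpow_neg_five_halves_le hA0 ((le_max_right _ _).trans hx)
    calc A * x ^ (-(5 / 2 : ℝ)) ≤ 1 / 2 * (x ^ 2)⁻¹ := h1
      _ ≤ 1 / 2 * V₀ := by
          rw [hV₀]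
          have : (x ^ 2)⁻¹ ≤ (ℓ : ℝ) * (ℓ + 1) * (x ^ 2)⁻¹ :=
            le_mul_of_one_le_left (by positivity) hℓ1
          linarith
  obtain ⟨hlo, hhi⟩ := abs_le.1 hfar
  refine ⟨by linarith, by linarith, ?_⟩
  -- `(V₀ − W)² ≤ A² x^{-5} ≤ A² x^{-3} W`  (as `W ≥ V₀/2 ≥ x^{-2}`)
  have hsq : (V₀ - W) ^ 2 ≤ (A * x ^ (-(5 / 2 : ℝ))) ^ 2 := by
    rw [← sq_abs (V₀ - W), abs_sub_comm]
    exact pow_le_pow_left₀ (abs_nonneg _) hfar 2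
  have hWlow : (x ^ 2)⁻¹ ≤ W := by
    have hℓ2 : (2 : ℝ) ≤ (ℓ : ℝ) * (ℓ + 1) := by
      have : (1 : ℝ) ≤ ℓ := by exact_mod_cast hℓ
      nlinarith
    have : 2 * (x ^ 2)⁻¹ ≤ (ℓ : ℝ) * (ℓ + 1) * (x ^ 2)⁻¹ :=
      mul_le_mul_of_nonneg_right hℓ2 (by positivity)
    linarith
  calc (V₀ - W) ^ 2 ≤ (A * x ^ (-(5 / 2 : ℝ))) ^ 2 := hsq
    _ = A ^ 2 * x ^ (-(3 : ℝ)) * (x ^ 2)⁻¹ := by rw [mul_pow, rpow_neg_five_halves_sq hx0]; ring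
    _ ≤ A ^ 2 * x ^ (-(3 : ℝ)) * W := mul_le_mul_of_nonneg_left hWlow (by positivity)

/-- **Far bound for `ℓ = 0`** (`s = 0`): along the centred unit-mass tortoise line `r(x) ≥ x/3` for
`x > 0` (from `r + 2 log(r − 2) − 3 = x` and `log u ≤ u − 1`), whence
`V = (1 − 2/r)·2/r³ ≤ 54/x³`. [folklore] -/
theorem far_bound_zero {x : ℝ} (hx : 0 < x) :
    linePotential 1 0 0 (tortoiseRadius one_pos 0) x ≤ 54 * x ^ (-(3 : ℝ)) := by
  have hr := isTortoiseRadius_tortoiseRadius one_pos (0 : ℝ)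
  set ρ : ℝ := tortoiseRadius one_pos 0 x with hρ
  have h2 : 2 < ρ := by have := hr.two_mul_lt x; linarith
  have htc := hr.tortoiseCoord_eq x
  rw [sub_zero] at htc
  unfold tortoiseCoord at htc
  have hlog : Real.log (ρ - 2 * 1) ≤ ρ - 2 * 1 - 1 := Real.log_le_sub_one_of_pos (by linarith)
  have hρx : x / 3 ≤ ρ := by
    rw [Real.log_one] at htc
    have : x ≤ 3 * ρ := by nlinarith
    linarith
  have hρ0 : 0 < ρ := by linarith
  have hx3 : 0 < x / 3 := by positivity
  simp only [linePotential_apply, rwPotential, Nat.cast_zero, zero_mul, zero_div, zero_add]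
  rw [← hρ, show ((1 : ℝ) - 0 ^ 2) * (2 * 1) = 2 * 1 by norm_num]
  have hfac : 1 - 2 * 1 / ρ ≤ 1 := by
    have : 0 ≤ 2 * 1 / ρ := by positivity
    linarith
  have hfac0 : 0 ≤ 1 - 2 * 1 / ρ := by
    rw [sub_nonneg, div_le_one hρ0]; linarith
  have hcube : 2 * 1 / ρ ^ 3 ≤ 2 / (x / 3) ^ 3 := by
    rw [mul_one]
    exact div_le_div_of_nonneg_left (by norm_num) (by positivity) (pow_le_pow_left₀ hx3.le hρx 3)
  have hrp : x ^ (-(3 : ℝ)) = (x ^ 3)⁻¹ := by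
    rw [rpow_neg hx.le, show (3 : ℝ) = ((3 : ℕ) : ℝ) by norm_num, rpow_natCast]
  calc (1 - 2 * 1 / ρ) * (2 * 1 / ρ ^ 3) ≤ 1 * (2 / (x / 3) ^ 3) :=
        mul_le_mul hfac hcube (by positivity) (by norm_num)
    _ = 54 * x ^ (-(3 : ℝ)) := by rw [hrp]; field_simp; ring

end FarHalfShareModel

end Summit.FinalStateConjecture.FinalStateConjecture.Theorems.WindowedShellChannelsSketch

end
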